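import Literature.NumberTheory.GaloisRepresentations.PstWeilDeligneHeredity
import HarnessLib

/-!
# Route `IrreducibilityBySelfDuality`, crux `ReciprocityUpToIrreducibility` (stmt-Langlands-14328),
# line `Sketch`: stub D1 `stub_deRhamBlocks` (de Rham heredity for block-triangular representations)

The registered stub `stub_deRhamBlocks` of the lead's skeleton, verbatim: for every non-archimedean
local field `F`, prime `ℓ` and `p`-adic Hodge datum `𝔇 : PstWeilDeligneData F ℓ`, the diagonal blocks
`A`, `D` of a framed `T : Γ_F →ₜ* GL_n(ℚ̄_ℓ)` which is block upper triangular along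
`e : Fin m ⊕ Fin p ≃ Fin n` and de Rham for `𝔇` are de Rham for `𝔇`.  It is the Literature theorem
`Literature.NumberTheory.GaloisRepresentations.PstWeilDeligneData.isDeRhamFramed_blocks`
(`Literature/NumberTheory/GaloisRepresentations/PstWeilDeligneHeredity.lean`: Fontaine, Astérisque 223,
Exposé III, Prop. 1.5.2 — sub-objects and quotients of `B`-admissible representations are
`B`-admissible — assembled with the descent of the frame to a finite coefficient field), applied.
No definitions; axioms `propext`, `Classical.choice`, `Quot.sound`.
-/

noncomputable section

set_option linter.dupNamespace false -- project-wide option (lakefile weak.linter.dupNamespace); `Summit.Langlands.Langlands` is the mandated namespace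

open Literature.NumberTheory.GaloisRepresentations

namespace Summit.Langlands.Langlands.Theorems.ReciprocityUpToIrreducibility

/-- **stub D1 (de Rham heredity for block-triangular framed representations; Fontaine Exp. III
Prop. 1.5.2: for a regular `(ℚ_ℓ, Γ)`-ring `B`, `B`-admissible representations are stable under
sub-objects and quotients).**  For ANY `p`-adic Hodge datum `𝔇` of a local field `F` (its period
ring is regular by the `PeriodRingData` axioms; Fontaine's inequality `finrank_D_le_holds` is proved
in the tree): if `T : Γ_F → GL_n(ℚ̄_ℓ)` is block upper triangular along `e : Fin m ⊕ Fin p ≃ Fin n`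
with diagonal blocks `A` (the sub-object) and `D` (the quotient), and `T` is de Rham for `𝔇`, then so
are `A` and `D`.  Proof: `PstWeilDeligneData.isDeRhamFramed_blocks` (Literature).
[cite: FontaineAsterisque223III, Prop. 1.5.2] -/
theorem stub_deRhamBlocks :
    ∀ (F : Type) [Field F] [ValuativeRel F] [TopologicalSpace F] [IsNonarchimedeanLocalField F]
      (ℓ : ℕ) [Fact ℓ.Prime] (𝔇 : PstWeilDeligneData F ℓ) (m p n : ℕ) (e : Fin m ⊕ Fin p ≃ Fin n)
      (T : FramedRep (Field.absoluteGaloisGroup F) (PadicAlgCl ℓ) n)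
      (A : FramedRep (Field.absoluteGaloisGroup F) (PadicAlgCl ℓ) m)
      (D : FramedRep (Field.absoluteGaloisGroup F) (PadicAlgCl ℓ) p),
      (∀ g, ∃ B : Matrix (Fin m) (Fin p) (PadicAlgCl ℓ),
        ((T g : GL (Fin n) (PadicAlgCl ℓ)) : Matrix (Fin n) (Fin n) (PadicAlgCl ℓ)) =
          Matrix.reindex e e (Matrix.fromBlocks
            ((A g : GL (Fin m) (PadicAlgCl ℓ)) : Matrix (Fin m) (Fin m) (PadicAlgCl ℓ)) B 0
            ((D g : GL (Fin p) (PadicAlgCl ℓ)) : Matrix (Fin p) (Fin p) (PadicAlgCl ℓ)))) →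
      𝔇.IsDeRhamFramed T → 𝔇.IsDeRhamFramed A ∧ 𝔇.IsDeRhamFramed D :=
  fun _F _ _ _ _ _ℓ _ 𝔇 _m _p _n e _T _A _D hT hdR => 𝔇.isDeRhamFramed_blocks e hT hdR

end Summit.Langlands.Langlands.Theorems.ReciprocityUpToIrreducibility

end
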